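import Summits.ResolutionOfSingularities.ResolutionOfSingularities.Theorems.UniversalCellsCampaignW82FiniteTwistCurves
import Mathlib.FieldTheory.RatFunc.AsPolynomial
import Mathlib.FieldTheory.PurelyInseparable.Basic
import Mathlib.RingTheory.Localization.BaseChange
import Mathlib.RingTheory.Localization.Away.Basic
import Mathlib.RingTheory.KrullDimension.Polynomial
import Mathlib.RingTheory.Polynomial.Basic
import Mathlib.RingTheory.Flat.Basic
import Mathlib.Algebra.CharP.Frobenius
import HarnessLib

/-!
# [OURS · L1 W8.2] Algebra for THE INVERSE OF THE PERFECTION STEP: rational points in subalgebras of `M(t)^{perf}`,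
# and `E ⊗_M M(t)` is a domain

Cell `res-hironaka` (run/shared/lean/pub/res-hironaka/), LADDER-RESOLUTION rung L (RESCUE), slot W8.2; host route
`UniversalCells`, host item `PrimeFieldToPerfect` (stmt-ResolutionOfSingularities-15233), door 1. Proofs file
(Theses-free; imports `…FiniteTwistCurves` only for the topological lemma
`finite_of_isClosed_of_ne_univ_of_topologicalKrullDim_le_one`), written by res-L1-s82-pv-1 (gen 4).

The two hypotheses of `CampaignW82.hasResolution_of_hasResolution_baseChange_of_rationalPoints`
(`…PerfectionSpecialization.lean`) for the extension `M ⊆ L`, `M` PERFECT, `L ⊇ M(t)` purely inseparable (e.g.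
`L = M(t)^{perf}`), are supplied here on the algebra side:

* §1 `isDomain_ratFunc_tensor` / `isDomain_tensor_ratFunc` — for every field `E ⊇ M`, `M(t) ⊗_M E` (a localisation
  of `E[t]`, Mathlib `IsLocalization.tensorProduct_tensorProduct`) is a domain — the generic fibre of
  `X ×_M M(t) ⟶ X` is irreducible;
* §2 `exists_rationalPoint_of_ringHom_ratFunc` — RATIONAL POINTS ARE DENSE: for `M` infinite, `R` a finitely
  generated `M`-algebra with an injective ring map `φ : R → M(t)` that is `M`-semilinear along an automorphism `σ` of
  `M`, every non-empty open subset of `Spec R` contains a maximal ideal `𝔪` with `M → R/𝔪` bijective (clear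
  denominators: `R ⊆ M[t][1/Q]`, whose spectrum is an irreducible Noetherian curve, so the non-empty open set misses
  only finitely many of the infinitely many points `t = a`, `Q(a) ≠ 0`);
* §3 `exists_rationalPoint_of_algHom_of_isPurelyInseparable` — the same for an injective `M`-ALGEBRA map
  `ψ : R → L` into a perfect `L` purely inseparable over `M(t)`, `M` perfect of characteristic `p`: some `Frob^e ∘ ψ`
  lands in `M(t)` and is semilinear along `Frob^e`, an automorphism of the perfect `M`.

HONEST FRAMING. OURS lemmas (commutative algebra, folklore); NOT statements of H. Hironaka's manuscript; nothing
attributed to its author. AI work, weaker than expert review.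
-/

noncomputable section

set_option linter.dupNamespace false -- mandated namespace of this single-conjunct summit

open Polynomial TensorProduct

namespace Summit.ResolutionOfSingularities.ResolutionOfSingularities.Theorems.CampaignW82

/-! ## §1 `M(t) ⊗_M E` is a domain -/

/-- **`M(t) ⊗_M E` is a domain** for fields `M ⊆ E`: it is the localisation of `M[t] ⊗_M E ≅ E[t]` (a domain) at the
image of `M[t] ∖ 0`, which consists of non-zero-divisors. [folklore] -/
theorem isDomain_ratFunc_tensor (M E : Type) [Field M] [Field E] [Algebra M E] : IsDomain (RatFunc M ⊗[M] E) := by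
  -- `M[t] ⊗_M E ≅ E[t]` is a domain
  let e₀ : M[X] ⊗[M] E ≃ₐ[M] E[X] :=
    (Algebra.TensorProduct.comm M M[X] E).trans (polyEquivTensor M E).symm
  haveI : IsDomain (M[X] ⊗[M] E) := MulEquiv.isDomain E[X] e₀.toMulEquiv
  -- `M(t) ⊗_M E` is its localisation at the image of `M[t]⁰`
  letI : Algebra (M[X] ⊗[M] E) (RatFunc M ⊗[M] E) :=
    (Algebra.TensorProduct.map (IsScalarTower.toAlgHom M M[X] (RatFunc M)) (AlgHom.id M E)).toRingHom.toAlgebra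
  haveI : IsScalarTower M[X] (M[X] ⊗[M] E) (RatFunc M ⊗[M] E) :=
    IsScalarTower.of_algebraMap_eq (R := M[X]) (S := M[X] ⊗[M] E) (A := RatFunc M ⊗[M] E) fun P => by
    rw [RingHom.algebraMap_toAlgebra, Algebra.TensorProduct.algebraMap_apply, AlgHom.toRingHom_eq_coe,
      AlgHom.coe_toRingHom, Algebra.TensorProduct.algebraMap_apply, Algebra.algebraMap_self, RingHom.id_apply,
      Algebra.TensorProduct.map_tmul, map_one, IsScalarTower.coe_toAlgHom']
  have H : (algebraMap (M[X] ⊗[M] E) (RatFunc M ⊗[M] E)).comp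
      Algebra.TensorProduct.includeRight.toRingHom = Algebra.TensorProduct.includeRight.toRingHom := by
    ext x
    simp [RingHom.algebraMap_toAlgebra]
  haveI hloc := IsLocalization.tensorProduct_tensorProduct M E (nonZeroDivisors M[X]) (RatFunc M) H
  refine IsLocalization.isDomain_of_le_nonZeroDivisors (R := M[X] ⊗[M] E) (RatFunc M ⊗[M] E)
    (M := Algebra.algebraMapSubmonoid (M[X] ⊗[M] E) (nonZeroDivisors M[X])) ?_
  rintro _ ⟨P, hP, rfl⟩
  refine mem_nonZeroDivisors_of_ne_zero ?_
  rw [Algebra.TensorProduct.algebraMap_apply, Algebra.algebraMap_self, RingHom.id_apply]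
  intro h0
  have hinj := Algebra.TensorProduct.includeLeft_injective (R := M) (A := M[X]) (S := M) (B := E)
    (algebraMap M E).injective
  exact nonZeroDivisors.ne_zero hP (hinj (by simpa using h0))

/-- The same with the factors swapped: **`E ⊗_M M(t)` is a domain.** [folklore] -/
theorem isDomain_tensor_ratFunc (M E : Type) [Field M] [Field E] [Algebra M E] : IsDomain (E ⊗[M] RatFunc M) :=
  haveI := isDomain_ratFunc_tensor M E
  MulEquiv.isDomain (RatFunc M ⊗[M] E) (Algebra.TensorProduct.comm M E (RatFunc M)).toMulEquiv


/-! ## §2 Rational points of finitely generated subalgebras of `M(t)` -/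

/-- **The points `t = a` of `Spec M[t][1/Q]`**: for `a ∈ M` with `Q(a) ≠ 0`, evaluation at `a` extends to
`M[t][1/Q] → M`; its kernel is a maximal ideal with residue field `M`, containing `t − a`. [folklore] -/
theorem exists_eval_away (M : Type) [Field M] (Q : M[X]) (a : M) (ha : Q.eval a ≠ 0) :
    ∃ ev : Localization.Away Q →+* M, (∀ P : M[X], ev (algebraMap M[X] (Localization.Away Q) P) = P.eval a) ∧
      ∀ c : M, ev (algebraMap M (Localization.Away Q) c) = c := by
  have hu : IsUnit (Polynomial.evalRingHom a Q) := isUnit_iff_ne_zero.mpr ha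
  refine ⟨IsLocalization.Away.lift Q hu, fun P => IsLocalization.Away.lift_eq Q hu P, fun c => ?_⟩
  rw [IsScalarTower.algebraMap_apply M M[X] (Localization.Away Q), IsLocalization.Away.lift_eq]
  change (Polynomial.C c).eval a = c
  exact Polynomial.eval_C

/-- **`M`-RATIONAL CLOSED POINTS ARE DENSE in `Spec R` for `R` finitely generated over an infinite field `M` with
an injective ring map `φ : R → M(t)`, semilinear along an automorphism `σ` of `M`** (`φ(c·r) = σ(c)·φ(r)`):
every non-empty open `O ⊆ Spec R` contains a maximal ideal `𝔪` with `M → R/𝔪` bijective. Proof: clear the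
denominators of the images of generators — `φ(R) ⊆ B := M[t][1/Q] ⊆ M(t)`, so `φ` factors through an injective
`j : R → B`; `Spec B ⟶ Spec R` is dominant, so the preimage of `O` is a non-empty open subset of `Spec B`, an
irreducible Noetherian space of dimension `≤ 1` (a localisation of `M[t]`), whose complement is therefore FINITE
(`finite_of_isClosed_of_ne_univ_of_topologicalKrullDim_le_one`); the points `t = a`, `Q(a) ≠ 0`
(`exists_eval_away`) are infinitely many, so one of them lies in the preimage; its image `𝔪 = ker(R → B → M)` is
maximal with `M → R/𝔪` bijective (the composite `M → R → M` is `σ`). [folklore] -/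
theorem exists_rationalPoint_of_ringHom_ratFunc {M : Type} [Field M] [Infinite M] {R : Type} [CommRing R]
    [Algebra M R] [hft : Algebra.FiniteType M R] (φ : R →+* RatFunc M) (hφ : Function.Injective φ)
    (σ : M ≃+* M) (hσ : ∀ c : M, φ (algebraMap M R c) = algebraMap M (RatFunc M) (σ c))
    {O : Set (PrimeSpectrum R)} (hO : IsOpen O) (hne : O.Nonempty) :
    ∃ x ∈ O, x.asIdeal.IsMaximal ∧ Function.Bijective (algebraMap M (R ⧸ x.asIdeal)) := by
  classical
  obtain ⟨s, hs⟩ := hft.out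
  set K := RatFunc M with hK
  -- ### a common denominator `Q` of the `φ r`, `r ∈ s`, and `B = M[t][1/Q]`
  let Q : M[X] := ∏ r ∈ s, (φ r).denom
  have hQ0 : Q ≠ 0 := Finset.prod_ne_zero_iff.mpr fun r _ => RatFunc.denom_ne_zero (φ r)
  let B : Type := Localization.Away Q
  have hQle : Submonoid.powers Q ≤ nonZeroDivisors M[X] := powers_le_nonZeroDivisors_of_noZeroDivisors hQ0
  haveI : IsDomain B := IsLocalization.isDomain_localization hQle
  haveI : IsNoetherianRing B := IsLocalization.isNoetherianRing (Submonoid.powers Q) B inferInstance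
  have halg_inj : Function.Injective (algebraMap M[X] K) := IsFractionRing.injective M[X] K
  -- ### `jB : B → M(t)`, injective
  have hQK : IsUnit (algebraMap M[X] K Q) := isUnit_iff_ne_zero.mpr ((map_ne_zero_iff _ halg_inj).mpr hQ0)
  let jB : B →+* K := IsLocalization.Away.lift Q hQK
  have hjB_alg : ∀ P : M[X], jB (algebraMap M[X] B P) = algebraMap M[X] K P :=
    fun P => IsLocalization.Away.lift_eq Q hQK P
  have hjB_M : ∀ c : M, jB (algebraMap M B c) = algebraMap M K c := fun c => by
    rw [IsScalarTower.algebraMap_apply M M[X] B, hjB_alg, ← IsScalarTower.algebraMap_apply M M[X] K]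
  have hjB_inj : Function.Injective jB := by
    rw [RingHom.injective_iff_ker_eq_bot]
    have hcomap : (RingHom.ker jB).under M[X] = ⊥ := by
      change (RingHom.ker jB).comap (algebraMap M[X] B) = ⊥
      rw [RingHom.comap_ker, IsLocalization.Away.lift_comp, ← RingHom.injective_iff_ker_eq_bot]
      exact halg_inj
    rw [← IsLocalization.map_under (Submonoid.powers Q) B (RingHom.ker jB), hcomap, Ideal.map_bot]
  -- ### `φ(R) ⊆ jB(B)`: true on generators (denominators divide `Q`) and on `M`
  have hmem : ∀ r : R, φ r ∈ jB.range := by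
    let T : Subalgebra M R :=
      { (jB.range.comap φ : Subring R) with
        algebraMap_mem' := fun c => ⟨algebraMap M B (σ c), by rw [hjB_M, ← hσ]⟩ }
    have hsT : (↑s : Set R) ⊆ T := by
      intro r hr
      change φ r ∈ jB.range
      have hdvd : (φ r).denom ∣ Q := Finset.dvd_prod_of_mem _ hr
      obtain ⟨u, hu⟩ := IsLocalization.Away.isUnit_of_dvd (S := B) (x := Q) hdvd
      refine ⟨algebraMap M[X] B (φ r).num * ↑u⁻¹, ?_⟩
      have hu' : jB ↑u⁻¹ = (algebraMap M[X] K (φ r).denom)⁻¹ := by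
        rw [map_units_inv, hu, hjB_alg]
      rw [map_mul, hu', hjB_alg, ← div_eq_mul_inv, RatFunc.num_div_denom]
    have hT : T = ⊤ := top_le_iff.mp (hs ▸ Algebra.adjoin_le hsT)
    intro r
    have : r ∈ T := hT ▸ Algebra.mem_top
    exact this
  -- ### the factorisation `j : R → B`, `jB ∘ j = φ`, injective, `j(c) = σ(c)`
  have hrr_inj : Function.Injective jB.rangeRestrict := fun b₁ b₂ h => hjB_inj (congrArg Subtype.val h)
  let eB : B ≃+* jB.range := RingEquiv.ofBijective jB.rangeRestrict ⟨hrr_inj, jB.rangeRestrict_surjective⟩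
  let j : R →+* B := eB.symm.toRingHom.comp (φ.codRestrict jB.range hmem)
  have hj : ∀ r, jB (j r) = φ r := fun r => by
    have h1 : (eB (eB.symm (φ.codRestrict jB.range hmem r)) : K) = φ r := by
      rw [eB.apply_symm_apply]; rfl
    exact h1
  have hj_inj : Function.Injective j := fun r₁ r₂ h => hφ (by rw [← hj, ← hj, h])
  have hj_M : ∀ c : M, j (algebraMap M R c) = algebraMap M B (σ c) := fun c =>
    hjB_inj (by rw [hj, hσ, hjB_M])
  -- ### `Spec B ⟶ Spec R` is dominant; the preimage `O'` of `O` is a non-empty open with finite complement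
  let cj : PrimeSpectrum B → PrimeSpectrum R := PrimeSpectrum.comap j
  have hcj : Continuous cj := PrimeSpectrum.continuous_comap j
  have hdense : DenseRange cj := by
    rw [PrimeSpectrum.denseRange_comap_iff_ker_le_nilRadical, (RingHom.injective_iff_ker_eq_bot j).mp hj_inj]
    exact bot_le
  have hO'ne : (cj ⁻¹' O).Nonempty := hdense.exists_mem_open hO hne
  have hdimB : topologicalKrullDim (PrimeSpectrum B) ≤ 1 := by
    rw [PrimeSpectrum.topologicalKrullDim_eq_ringKrullDim]
    have hmono : StrictMono (PrimeSpectrum.comap (algebraMap M[X] B)) :=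
      Monotone.strictMono_of_injective (fun p q h => Ideal.comap_mono h)
        (PrimeSpectrum.localization_comap_injective B (Submonoid.powers Q))
    refine (Order.krullDim_le_of_strictMono _ hmono).trans ?_
    change ringKrullDim M[X] ≤ 1
    rw [Polynomial.ringKrullDim_of_isNoetherianRing, ringKrullDim_eq_zero_of_field]
    rfl
  have hfin : (cj ⁻¹' O)ᶜ.Finite := by
    refine finite_of_isClosed_of_ne_univ_of_topologicalKrullDim_le_one hdimB (hO.preimage hcj).isClosed_compl ?_
    intro h
    obtain ⟨b, hb⟩ := hO'ne
    exact (h ▸ Set.mem_univ b : b ∈ (cj ⁻¹' O)ᶜ) hb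
  -- ### the points `t = a`, `Q(a) ≠ 0`: infinitely many, pairwise distinct
  let A : Type := {a : M // Q.eval a ≠ 0}
  haveI : Infinite A := by
    have hroots : {a : M | Q.eval a = 0}.Finite :=
      (Q.roots.toFinset.finite_toSet).subset fun a ha => by
        simpa [Polynomial.mem_roots hQ0] using ha
    exact (hroots.infinite_compl).to_subtype
  have hev := fun a : A => exists_eval_away M Q a.1 a.2
  choose ev hevP hevM using hev
  let m : A → PrimeSpectrum B := fun a => ⟨RingHom.ker (ev a), RingHom.ker_isPrime _⟩
  have hm_inj : Function.Injective m := by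
    intro a a' h
    have hmem : algebraMap M[X] B (X - Polynomial.C a.1) ∈ RingHom.ker (ev a') := by
      have : algebraMap M[X] B (X - Polynomial.C a.1) ∈ RingHom.ker (ev a) := by
        rw [RingHom.mem_ker, hevP]; simp
      have h' : RingHom.ker (ev a) = RingHom.ker (ev a') := congrArg PrimeSpectrum.asIdeal h
      rwa [h'] at this
    rw [RingHom.mem_ker, hevP] at hmem
    simp only [eval_sub, eval_X, eval_C, sub_eq_zero] at hmem
    exact Subtype.ext hmem.symm
  -- ### one of them lies in `O'`
  obtain ⟨a, ha⟩ : ∃ a : A, m a ∈ cj ⁻¹' O := by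
    by_contra hcon
    simp only [not_exists] at hcon
    have hsub : Set.range m ⊆ (cj ⁻¹' O)ᶜ := by rintro _ ⟨a, rfl⟩; exact hcon a
    haveI : Finite (Set.range m) := (hfin.subset hsub).to_subtype
    haveI : Finite A := Finite.of_injective_finite_range hm_inj
    exact not_finite A
  -- ### its image `x = ker (ev ∘ j)`
  let θ : R →+* M := (ev a).comp j
  have hθM : ∀ c : M, θ (algebraMap M R c) = σ c := fun c => by
    change ev a (j (algebraMap M R c)) = σ c
    rw [hj_M, hevM]
  have hθsurj : Function.Surjective θ := fun c => ⟨algebraMap M R (σ.symm c), by rw [hθM, σ.apply_symm_apply]⟩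
  have hxeq : (cj (m a)).asIdeal = RingHom.ker θ := RingHom.comap_ker (ev a) j
  refine ⟨cj (m a), ha, ?_, ?_⟩
  · rw [hxeq]; exact RingHom.ker_isMaximal_of_surjective θ hθsurj
  · let e : R ⧸ (cj (m a)).asIdeal ≃+* M :=
      (Ideal.quotEquivOfEq hxeq).trans (RingHom.quotientKerEquivOfSurjective hθsurj)
    have he : ∀ c : M, e (algebraMap M (R ⧸ (cj (m a)).asIdeal) c) = σ c := fun c => by
      rw [← Ideal.Quotient.mk_algebraMap]
      change RingHom.quotientKerEquivOfSurjective hθsurj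
        (Ideal.quotEquivOfEq hxeq (Ideal.Quotient.mk _ (algebraMap M R c))) = σ c
      rw [Ideal.quotEquivOfEq_mk, RingHom.quotientKerEquivOfSurjective_apply_mk, hθM]
    have hcomp : (algebraMap M (R ⧸ (cj (m a)).asIdeal) : M → _) = e.symm ∘ σ := by
      funext c
      exact e.injective (by rw [he]; simp)
    rw [hcomp]
    exact e.symm.bijective.comp σ.bijective


/-! ## §3 Rational points of finitely generated subalgebras of a perfect purely inseparable extension of `M(t)` -/

/-- **`M`-RATIONAL CLOSED POINTS ARE DENSE in `Spec R` for `R` finitely generated over an INFINITE PERFECT field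
`M` of characteristic `p` with an injective `M`-algebra map `ψ : R → L` into a field `L ⊇ M(t)` purely
inseparable over `M(t)`** (e.g. `L = M(t)^{perf}`): every non-empty open `O ⊆ Spec R` contains a maximal ideal `𝔪`
with `M → R/𝔪` bijective. Some power `Frob^e` sends the images of the generators of `R` — hence all of `ψ(R)` —
into `M(t)`, so `φ := Frob^e ∘ ψ : R → M(t)` is an injective ring map, semilinear along the AUTOMORPHISM `Frob^e`
of the perfect `M`; apply `exists_rationalPoint_of_ringHom_ratFunc`. [folklore] -/
theorem exists_rationalPoint_of_algHom_of_isPurelyInseparable (p : ℕ) [hp : Fact p.Prime] {M : Type} [Field M]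
    [CharP M p] [PerfectField M] [Infinite M] {L : Type} [Field L] [Algebra (RatFunc M) L]
    [IsPurelyInseparable (RatFunc M) L] [Algebra M L] [IsScalarTower M (RatFunc M) L]
    {R : Type} [CommRing R] [Algebra M R] [hft : Algebra.FiniteType M R] (ψ : R →ₐ[M] L)
    (hψ : Function.Injective ψ) {O : Set (PrimeSpectrum R)} (hO : IsOpen O) (hne : O.Nonempty) :
    ∃ x ∈ O, x.asIdeal.IsMaximal ∧ Function.Bijective (algebraMap M (R ⧸ x.asIdeal)) := by
  classical
  set K := RatFunc M with hK
  haveI : CharP L p := charP_of_injective_algebraMap (algebraMap K L).injective p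
  haveI : ExpChar L p := ExpChar.prime hp.out
  haveI : ExpChar M p := ExpChar.prime hp.out
  obtain ⟨s, hs⟩ := hft.out
  -- ### a common Frobenius exponent `e` for the generators
  have hpow := fun r : R => IsPurelyInseparable.pow_mem K p (ψ r)
  choose n hn using hpow
  let e : ℕ := s.sup n
  have hgen : ∀ r ∈ s, ψ r ^ p ^ e ∈ (algebraMap K L).range := by
    intro r hr
    have hle : n r ≤ e := Finset.le_sup hr
    rw [← Nat.add_sub_cancel' hle, pow_add, pow_mul]
    exact Subring.pow_mem _ (hn r) _
  -- ### `φ₀ = Frob^e ∘ ψ` lands in `M(t)`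
  let φ₀ : R →+* L := (iterateFrobenius L p e).comp ψ.toRingHom
  have hφ₀ : ∀ r, φ₀ r = ψ r ^ p ^ e := fun r => iterateFrobenius_def ..
  have hφ₀M : ∀ c : M, φ₀ (algebraMap M R c) = algebraMap K L (algebraMap M K (c ^ p ^ e)) := fun c => by
    rw [hφ₀, AlgHom.commutes, ← map_pow, IsScalarTower.algebraMap_apply M K L]
  have hmemL : ∀ r : R, φ₀ r ∈ (algebraMap K L).range := by
    let T : Subalgebra M R :=
      { ((algebraMap K L).range.comap φ₀ : Subring R) with
        algebraMap_mem' := fun c => ⟨algebraMap M K (c ^ p ^ e), (hφ₀M c).symm⟩ }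
    have hsT : (↑s : Set R) ⊆ T := fun r hr => by
      change φ₀ r ∈ (algebraMap K L).range
      rw [hφ₀]; exact hgen r hr
    have hT : T = ⊤ := top_le_iff.mp (hs ▸ Algebra.adjoin_le hsT)
    intro r
    have : r ∈ T := hT ▸ Algebra.mem_top
    exact this
  -- ### `φ : R → M(t)` with `algebraMap ∘ φ = φ₀`
  have hrr_inj : Function.Injective (algebraMap K L).rangeRestrict :=
    fun b₁ b₂ h => (algebraMap K L).injective (congrArg Subtype.val h)
  let eKL : K ≃+* (algebraMap K L).range :=
    RingEquiv.ofBijective (algebraMap K L).rangeRestrict ⟨hrr_inj, (algebraMap K L).rangeRestrict_surjective⟩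
  let φ : R →+* K := eKL.symm.toRingHom.comp (φ₀.codRestrict (algebraMap K L).range hmemL)
  have hφ : ∀ r, algebraMap K L (φ r) = φ₀ r := fun r => by
    have h1 : (eKL (eKL.symm (φ₀.codRestrict (algebraMap K L).range hmemL r)) : L) = φ₀ r := by
      rw [eKL.apply_symm_apply]; rfl
    exact h1
  have hφ_inj : Function.Injective φ := by
    intro r₁ r₂ h
    have h' : φ₀ r₁ = φ₀ r₂ := by rw [← hφ, ← hφ, h]
    rw [hφ₀, hφ₀] at h'
    have h'' : iterateFrobenius L p e (ψ r₁) = iterateFrobenius L p e (ψ r₂) := by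
      rwa [iterateFrobenius_def, iterateFrobenius_def]
    exact hψ (iterateFrobenius_inj L p e h'')
  -- ### semilinearity along `Frob^e`, an automorphism of the perfect `M`
  let σ : M ≃+* M := iterateFrobeniusEquiv M p e
  have hσ : ∀ c : M, φ (algebraMap M R c) = algebraMap M K (σ c) := fun c =>
    (algebraMap K L).injective (by rw [hφ, hφ₀M, iterateFrobeniusEquiv_def])
  exact exists_rationalPoint_of_ringHom_ratFunc φ hφ_inj σ hσ hO hne

end Summit.ResolutionOfSingularities.ResolutionOfSingularities.Theorems.CampaignW82

end
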